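import Summits.QuantumFields.YangMills.Theorems.FluctuationComparisonRegPrIntLS2BetaSupTowerTerm
import HarnessLib
/-!
# S2β · AVG₂♭-ax_q, THE SUP CHAIN's KNIT — «LOC ⟸ (BR) ∧ (D2-loc) ∧ (ST)»: the local letter `hLoc` of ✓p828403 (TAYLOR♭_q ⟸ `hLoc`, AVG₂♭-ax_q ⟸ `hLoc`) follows,
# at fixed data and then in its own `∀ L ∃ C_T ∃ c …` prefix, from Q7's telescope, px5 g23's one-step bracket bound (BR) = Q9b and local-sup propagation (D2-loc) = Q10,
# and ONE remaining tower letter — the SUP TOWER BUDGET (ST) (UV3-NODE §94; px16 g22 LANE RULING 16:37:04Z: the road of record)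

Cell `ym3-torus` (YM ladder rung R3 = continuum `SU(2)` Yang–Mills on the three-torus at fixed lattice data — a RUNG: NOT d = 4, NOT infinite volume, NOT a mass gap,
NOT Clay).  Width seat «width 17» `ym3-torus-px17` (gen 22); crux `stmt-QuantumFields-20520` (`…Theses.UnitScaleTilt.FluctuationComparisonRegPrIntL`), LINE g18-1 S2β,
organ GAP♯∘ ⟸ {h3, (D-stage)×2, LOC} by kernel (px16 g22 `…GapOrbitAtStageAxial` ∘ ✓p828403 `avg2_of_local`).  `--kind proof --supports stmt-QuantumFields-20520 --as helper`,
count-neutral, DEFINITION-FREE (0 `def`, 0 `instance`, 0 `notation`, 0 `sorry`).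

THE CHAIN (UV3-NODE §94.4; px20 g23's (5) design note 16:37:45Z).  With `W := expPoint ζ • U₀`, `η⁽ᵘ⁾` the chord field of the descended pair at level `u` (`η⁽ᴷ⁾ = sinc‖ζ‖•ζ`),
`T_t := DMq_{J←J+t}(D_{J+t,K}U₀)`, `br_t := η⁽ᴶ⁺ᵗ⁾ − S_t η⁽ᴶ⁺ᵗ⁺¹⁾` (`S_t` = the one-step linearisation at base `D_{J+t+1,K}U₀`):
  `Σ_B ‖Mq ζ B − DMq (sinc ζ) B‖ = Σ_B ‖Σ_{t<k} (T_t br_t)(B)‖`   (Q7 ✓p827759 `chord_sub_fderiv_qRead_chord_eq_sum`, Q6 ✓p827555 `imVec_su2Quat_expPoint`)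
  `≤ Σ_t Σ_B ‖(T_t br_t)(B)‖ ≤ Σ_t C_P·L^t·Σ_B ‖br_t^{(B)}‖_∞`   ((D2-loc) = Q10 `sum_norm_qfderiv_apply_le_local` at `(J, J+t)`, base `D_{J+t,K}U₀ ∈ histGood` by Q7 §1)
  `≤ Σ_t C_P·L^t·Σ_B C_br·ℓ²·‖log η⁽ᴶ⁺ᵗ⁺¹⁾|_{READ_t(B)}‖²_∞`   ((BR) = Q9b `norm_oneStepBracket_le` bond by bond; read sets composed)
  `≤ C_P·C_br·ℓ²·[(ST)'s left side] ≤ C_P·C_br·ℓ²·C_ST·e^{c_ST·Σθ}·(N⁻¹·Σ‖ζ‖² + N·REL)`.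
`C_P = (1 + 4(d+2))·exp(c₃·Σ_{i<K−J}(5L)²∕4·θ(K−i))` (Q10's constant; a sub-tower's history sum is bounded by the full tower's), `c₃ = (d+2)(422 + 1616(d+2))`, `C_br = 4551000`,
`ℓ = (d+2)L`, `d = 3` — so LOC's constants are `C_T := (1 + 4·5)·4551000·(5L)²·C_ST` and `c := c₃ + c_ST`.

THE (ST) TEXT (HYPOTHESIS of record for the pairing lane's last analytic residue; intended discharger = the lift recursion over ✓p828013∕✓p828327 + px12's (R1) + the sup-curl tower
budget (SCT), UV3-NODE §94.5).  At fixed data: `Σ_{t<K−J} L^t·Σ_{B : PBond (F.P J) 0} ‖(ℓ′ ↦ if ℓ′ ∈ READ_t(B) then logVec (su2Quat (D_{J+t+1,K}W ℓ′·(D_{J+t+1,K}U₀ ℓ′)⁻¹)) else 0)‖² ≤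
C_ST·e^{c_ST·Σθ}·((L⁻¹)^{K−J}·Σ_ℓ‖ζ ℓ‖² + L^{K−J}·REL(W;U₀))`, `READ_t(B) := {ℓ′ : ∃ b : PBond (F.P (J+t)) 0, ⟨Q10's truncation condition of b w.r.t. B at (J, J+t)⟩ ∧ ⟨Q9b's
two-block condition of ℓ′ w.r.t. b⟩}` (all spelled inline below; «max over the read set» in def-free clothes = the Pi-sup norm of the truncated field).

WHAT IS PROVED (sorry-free; FILE 2 of 2 — FILE 1 = `…S2BetaSupTowerTerm`: `bracket_apply_le`, `truncate_bracket_le`, `term_le`).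
§4 ★★★`local_of_supTower (hST)` — AT FIXED DATA (`F, J ≤ K, θ, α` with Q1's guards, `U₀ ∈ histGood θ K J`, `ζ`): LOC's inner inequality from the (ST) hypothesis at that data.
§5 ★★★`loc_of_supTowerLetter (G) (Ax) (hSTL)` — LOC = ✓p828403 `taylor_of_local`'s `hLoc` VERBATIM from the (ST) LETTER in LOC's own prefix (guards, `‖ζ ℓ‖ ≤ π`, partner ∈ histGood, `Ax`).

INHABITATION (★★OWNER RULING №100): LAW-FREE — (ST) is a statement about the sup sizes of the descended chord fields of the pair `(expPoint ζ • U₀, U₀)` along the tower; no fibre law,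
no score, no integrability.

HONEST SCOPE.  Bookkeeping (finite sums, Pi-sup norms) over Q6∕Q7∕Q9b∕Q10 by name; nothing of Bałaban's analysis is asserted or proved ([Balaban1985Averaging] Prop. 4 (134)–(135),
(139)–(147), Prop. 5 (148)–(157) are the printed SUP statements this chain transcribes; the tree's ℓ²-purse letter is stronger than print, §94.3); (ST), LOC, TAYLOR♭_q, AVG₂♭-ax_q,
(D-ax), h3 HYPOTHESES; GAP♯∘ (`stub_uniformFibreGapOrbit`, registry 3732b7df UNTOUCHED), S2β, the five registered stubs (0∕5), 20520, 19936, 19200, `YM3TorusSU2` are NOT proved;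
rung R3 — NOT d = 4, NOT infinite volume, NOT a mass gap, NOT Clay; the Yang–Mills mass gap is NOT proved.
-/

set_option autoImplicit false

noncomputable section

open scoped Matrix.Norms.L2Operator Topology RealInnerProductSpace Quaternion
open Set Function
open Literature.MathematicalPhysics.QuantumLattice (su2Quat)
open Literature.MathematicalPhysics.QuantumFieldTheory.Balaban1983to89
open Literature.MathematicalPhysics.QuantumFieldTheory.Balaban1983to89.T3ContinuumYM3Torus
open Literature.MathematicalPhysics.QuantumFieldTheory.Balaban1983to89.T3UnitLawDensityEML (ℰp)
open Literature.MathematicalPhysics.QuantumFieldTheory.Balaban1983to89.T3UnitScaleTilt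
open Literature.MathematicalPhysics.QuantumFieldTheory.Balaban1983to89.T3TiltDescent
open Literature.MathematicalPhysics.QuantumFieldTheory.Balaban1983to89.T3DescentFibreTower
open Literature.MathematicalPhysics.QuantumFieldTheory.Balaban1983to89.T3LevelShift
open Literature.MathematicalPhysics.QuantumFieldTheory.Balaban1983to89.ExpMeanLog (deltaSU)
open Literature.MathematicalPhysics.QuantumFieldTheory.Balaban1983to89.T4HaarSU2ExpChart (expPoint)
open Literature.MathematicalPhysics.QuantumFieldTheory.Balaban1983to89.T4ExpWindowSmallField (imVec logVec)
open Literature.MathematicalPhysics.QuantumFieldTheory.Balaban1983to89.T4Continuum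
open Summit.QuantumFields.YangMills.Theorems.FluctuationComparisonRegPrIntLS2BetaQuaternionReadFibreIdentity (imVec_su2Quat_expPoint)
open Summit.QuantumFields.YangMills.Theorems.FluctuationComparisonRegPrIntLS2BetaQuaternionReadTowerTelescope
  (chord_sub_fderiv_qRead_chord_eq_sum histGood_of_le descendTo_mem_histGood)
open Summit.QuantumFields.YangMills.Theorems.FluctuationComparisonRegPrIntLS2BetaQuaternionReadOneStepBracket (norm_oneStepBracket_le)
open Summit.QuantumFields.YangMills.Theorems.FluctuationComparisonRegPrIntLS2BetaQuaternionReadDerivLocalSup (sum_norm_qfderiv_apply_le_local)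
open Summit.QuantumFields.YangMills.Theorems.FluctuationComparisonRegPrIntLS2BetaSupTowerTerm (term_le)

namespace Summit.QuantumFields.YangMills.Theorems.FluctuationComparisonRegPrIntLS2BetaLocalOfSupTower

variable {F : T3Family}

/-! ## §4 LOC at fixed data from the (ST) hypothesis at that data -/

section Fixed

/-- ★★★ **LOC AT FIXED DATA FROM THE SUP TOWER BUDGET (ST) AT THAT DATA.**  Under Q1's guards at `(J, K)` with `U₀ ∈ histGood θ K J`, for EVERY `ζ` (no fibre condition,
no window beyond the descents' charts): if the descended chord fields of the pair `(expPoint ζ • U₀, U₀)` satisfy (ST) with constants `(C_ST, c_ST)`, then LOC's inequality holds with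
`C_T := (1 + 4·5)·4551000·(5L)²·C_ST` and `c := c₃ + c_ST`.  The chain: Q7 telescope + Q6 sinc input, then §3 term by term, then (ST).
[cite: Balaban1985Averaging, Prop. 3 (123) p.36, Prop. 4 (134)-(135) p.38, (139)-(147) pp.39-40; Balaban1987RG1, (0.4), (0.11) p.253; Balaban1985UV3, (7) p.257] -/
theorem local_of_supTower {J K : ℕ} (hJK : J ≤ K) {θ : ℕ → ℝ} (hθ0 : ∀ i, 0 ≤ θ i) {α : ℝ}
    (hθα : ∀ i, J < i → i ≤ K → (((5 * F.L : ℕ) : ℝ) ^ 2 / 4) * θ i ≤ α)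
    (hα24 : α ≤ 1 / 24) (hαδ : α < deltaSU (Fin 2)) (hαL : 157 * α < ((F.L : ℝ) ^ 2)⁻¹)
    {U₀ : GaugeField (F.P K) 0 (Matrix.specialUnitaryGroup (Fin 2) ℂ)} (hUg : U₀ ∈ histGood F ℰp θ K J)
    (ζ : PBond (F.P K) 0 → EuclideanSpace ℝ (Fin 3)) (C_ST c_ST : ℝ)
    (hST : ∑ t ∈ Finset.range (K - J), (if ht : t < K - J then
          (F.L : ℝ) ^ t * ∑ B : PBond (F.P J) 0,
            ‖(fun ℓ' : PBond (F.P (J + (t + 1))) 0 =>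
              if ∃ b : PBond (F.P (J + t)) 0,
                ((B14.Eq22Determines.blockIter (J + t - J) b.src = (bondShift (F.sitesPerDir_eq (m := F.m) (K := J) (j := 0) (m' := F.m) (K' := J + t) (j' := J + t - J) (by omega)) B).src ∨ B14.Eq22Determines.blockIter (J + t - J) b.src = (bondShift (F.sitesPerDir_eq (m := F.m) (K := J) (j := 0) (m' := F.m) (K' := J + t) (j' := J + t - J) (by omega)) B).tgt) ∧
                (B14.Eq22Determines.blockIter (J + t - J) b.tgt = (bondShift (F.sitesPerDir_eq (m := F.m) (K := J) (j := 0) (m' := F.m) (K' := J + t) (j' := J + t - J) (by omega)) B).src ∨ B14.Eq22Determines.blockIter (J + t - J) b.tgt = (bondShift (F.sitesPerDir_eq (m := F.m) (K := J) (j := 0) (m' := F.m) (K' := J + t) (j' := J + t - J) (by omega)) B).tgt)) ∧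
                (blockOf ℓ'.src = (bondShift (F.sitesPerDir_eq (m := F.m) (K := J + t) (j := 0) (m' := F.m) (K' := J + t + 1) (j' := 1) (by omega)) b).src ∨ blockOf ℓ'.src = (bondShift (F.sitesPerDir_eq (m := F.m) (K := J + t) (j := 0) (m' := F.m) (K' := J + t + 1) (j' := 1) (by omega)) b).tgt)
              then logVec (su2Quat (descendTo F ℰp (J + (t + 1)) K (by omega) (fun ℓ => expPoint (ζ ℓ) * U₀ ℓ : GaugeField (F.P K) 0 (Matrix.specialUnitaryGroup (Fin 2) ℂ)) ℓ' * (descendTo F ℰp (J + (t + 1)) K (by omega) U₀ ℓ')⁻¹)) else 0)‖ ^ 2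
        else 0) ≤
      C_ST * Real.exp (c_ST * ∑ i ∈ Finset.range (K - J), (((5 * F.L : ℕ) : ℝ) ^ 2 / 4) * θ (K - i)) * (((F.L : ℝ)⁻¹) ^ (K - J) * ∑ ℓ : PBond (F.P K) 0, ‖ζ ℓ‖ ^ 2 +
                (F.L : ℝ) ^ (K - J) * ∑ p : Plaq (F.P K) 0,
                  (1 - reTr ((GaugeField.plaqHol U₀ p)⁻¹ * GaugeField.plaqHol (fun ℓ => expPoint (ζ ℓ) * U₀ ℓ : GaugeField (F.P K) 0 (Matrix.specialUnitaryGroup (Fin 2) ℂ)) p)))) :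
    ∑ B : PBond (F.P J) 0, ‖imVec (su2Quat (descendTo F ℰp J K hJK (fun ℓ => expPoint (ζ ℓ) * U₀ ℓ) B * (descendTo F ℰp J K hJK U₀ B)⁻¹)) -
        (fderiv ℝ (fun (ζ : PBond (F.P K) 0 → EuclideanSpace ℝ (Fin 3)) (B : PBond (F.P J) 0) =>
          imVec (su2Quat (descendTo F ℰp J K hJK (fun ℓ => expPoint (ζ ℓ) * U₀ ℓ) B * (descendTo F ℰp J K hJK U₀ B)⁻¹))) 0)
          (fun ℓ => Real.sinc ‖ζ ℓ‖ • ζ ℓ) B‖ ≤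
      ((1 + 4 * ((3 + 2 : ℕ) : ℝ)) * (4551000 * ((5 * F.L : ℕ) : ℝ) ^ 2) * C_ST) *
        Real.exp ((((3 + 2 : ℕ) : ℝ) * (422 + 1616 * ((3 + 2 : ℕ) : ℝ)) + c_ST) * ∑ i ∈ Finset.range (K - J), (((5 * F.L : ℕ) : ℝ) ^ 2 / 4) * θ (K - i)) * (((F.L : ℝ)⁻¹) ^ (K - J) * ∑ ℓ : PBond (F.P K) 0, ‖ζ ℓ‖ ^ 2 +
                (F.L : ℝ) ^ (K - J) * ∑ p : Plaq (F.P K) 0,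
                  (1 - reTr ((GaugeField.plaqHol U₀ p)⁻¹ * GaugeField.plaqHol (fun ℓ => expPoint (ζ ℓ) * U₀ ℓ : GaugeField (F.P K) 0 (Matrix.specialUnitaryGroup (Fin 2) ℂ)) p))) := by
  obtain ⟨k, rfl⟩ := Nat.exists_eq_add_of_le hJK
  -- the partner and its finest chord field
  have hη : (fun ℓ : PBond (F.P (J + k)) 0 => imVec (su2Quat ((fun ℓ => expPoint (ζ ℓ) * U₀ ℓ : GaugeField (F.P (J + k)) 0 (Matrix.specialUnitaryGroup (Fin 2) ℂ)) ℓ * (U₀ ℓ)⁻¹))) =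
      fun ℓ => Real.sinc ‖ζ ℓ‖ • ζ ℓ := by
    funext ℓ
    show imVec (su2Quat (expPoint (ζ ℓ) * U₀ ℓ * (U₀ ℓ)⁻¹)) = _
    rw [mul_inv_cancel_right, imVec_su2Quat_expPoint]
  have htel := chord_sub_fderiv_qRead_chord_eq_sum (F := F) (J := J) hθ0 hα24 hαδ hαL k hθα hUg
    (fun ℓ => expPoint (ζ ℓ) * U₀ ℓ : GaugeField (F.P (J + k)) 0 (Matrix.specialUnitaryGroup (Fin 2) ℂ))
  rw [hη] at htel
  -- the left side, bond by bond, is the value of the telescoped sum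
  have hptw : ∀ B : PBond (F.P J) 0,
      imVec (su2Quat (descendTo F ℰp J (J + k) hJK (fun ℓ => expPoint (ζ ℓ) * U₀ ℓ) B * (descendTo F ℰp J (J + k) hJK U₀ B)⁻¹)) -
        (fderiv ℝ (fun (ζ : PBond (F.P (J + k)) 0 → EuclideanSpace ℝ (Fin 3)) (B : PBond (F.P J) 0) =>
          imVec (su2Quat (descendTo F ℰp J (J + k) hJK (fun ℓ => expPoint (ζ ℓ) * U₀ ℓ) B * (descendTo F ℰp J (J + k) hJK U₀ B)⁻¹))) 0)
          (fun ℓ => Real.sinc ‖ζ ℓ‖ • ζ ℓ) B =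
      (∑ t ∈ Finset.range k, if ht : t < k then
        (fderiv ℝ (fun (y : PBond (F.P (J + t)) 0 → EuclideanSpace ℝ (Fin 3)) (B : PBond (F.P J) 0) =>
            imVec (su2Quat (descendTo F ℰp J (J + t) (Nat.le_add_right J t)
              (fun b => expPoint (y b) * descendTo F ℰp (J + t) (J + k) (Nat.add_le_add_left ht.le J) U₀ b) B *
              (descendTo F ℰp J (J + t) (Nat.le_add_right J t) (descendTo F ℰp (J + t) (J + k) (Nat.add_le_add_left ht.le J) U₀) B)⁻¹))) 0)
          ((fun b => imVec (su2Quat (descendTo F ℰp (J + t) (J + k) (Nat.add_le_add_left ht.le J) (fun ℓ => expPoint (ζ ℓ) * U₀ ℓ : GaugeField (F.P (J + k)) 0 (Matrix.specialUnitaryGroup (Fin 2) ℂ)) b *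
              (descendTo F ℰp (J + t) (J + k) (Nat.add_le_add_left ht.le J) U₀ b)⁻¹))) -
            (fderiv ℝ (fun (w : PBond (F.P (J + (t + 1))) 0 → EuclideanSpace ℝ (Fin 3)) (b : PBond (F.P (J + t)) 0) =>
                imVec (su2Quat (descendTo F ℰp (J + t) (J + (t + 1)) (Nat.add_le_add_left (Nat.le_succ t) J)
                  (fun ℓ => expPoint (w ℓ) * descendTo F ℰp (J + (t + 1)) (J + k) (Nat.add_le_add_left (Nat.succ_le_of_lt ht) J) U₀ ℓ) b *
                  (descendTo F ℰp (J + t) (J + (t + 1)) (Nat.add_le_add_left (Nat.le_succ t) J)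
                    (descendTo F ℰp (J + (t + 1)) (J + k) (Nat.add_le_add_left (Nat.succ_le_of_lt ht) J) U₀) b)⁻¹))) 0)
              (fun ℓ => imVec (su2Quat (descendTo F ℰp (J + (t + 1)) (J + k) (Nat.add_le_add_left (Nat.succ_le_of_lt ht) J) (fun ℓ => expPoint (ζ ℓ) * U₀ ℓ : GaugeField (F.P (J + k)) 0 (Matrix.specialUnitaryGroup (Fin 2) ℂ)) ℓ *
                (descendTo F ℰp (J + (t + 1)) (J + k) (Nat.add_le_add_left (Nat.succ_le_of_lt ht) J) U₀ ℓ)⁻¹))))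
        else 0) B := fun B => by
    have := congrFun htel B
    rw [Pi.sub_apply] at this
    exact this
  -- constants are nonnegative; (ST)'s index set is `range k`
  have hCP0 : (0 : ℝ) ≤ ((1 + 4 * ((3 + 2 : ℕ) : ℝ)) * Real.exp (((3 + 2 : ℕ) : ℝ) * (422 + 1616 * ((3 + 2 : ℕ) : ℝ)) * ∑ i ∈ Finset.range (J + k - J), (((5 * F.L : ℕ) : ℝ) ^ 2 / 4) * θ (J + k - i))) * (4551000 * ((5 * F.L : ℕ) : ℝ) ^ 2) := by positivity
  have hrange : Finset.range (J + k - J) = Finset.range k := by rw [Nat.add_sub_cancel_left]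
  calc ∑ B : PBond (F.P J) 0, ‖imVec (su2Quat (descendTo F ℰp J (J + k) hJK (fun ℓ => expPoint (ζ ℓ) * U₀ ℓ) B * (descendTo F ℰp J (J + k) hJK U₀ B)⁻¹)) -
          (fderiv ℝ (fun (ζ : PBond (F.P (J + k)) 0 → EuclideanSpace ℝ (Fin 3)) (B : PBond (F.P J) 0) =>
            imVec (su2Quat (descendTo F ℰp J (J + k) hJK (fun ℓ => expPoint (ζ ℓ) * U₀ ℓ) B * (descendTo F ℰp J (J + k) hJK U₀ B)⁻¹))) 0)
            (fun ℓ => Real.sinc ‖ζ ℓ‖ • ζ ℓ) B‖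
      = ∑ B : PBond (F.P J) 0, ‖(∑ t ∈ Finset.range k, (if ht : t < k then
          (fderiv ℝ (fun (y : PBond (F.P (J + t)) 0 → EuclideanSpace ℝ (Fin 3)) (B : PBond (F.P J) 0) =>
            imVec (su2Quat (descendTo F ℰp J (J + t) (Nat.le_add_right J t)
              (fun b => expPoint (y b) * descendTo F ℰp (J + t) (J + k) (Nat.add_le_add_left ht.le J) U₀ b) B *
              (descendTo F ℰp J (J + t) (Nat.le_add_right J t) (descendTo F ℰp (J + t) (J + k) (Nat.add_le_add_left ht.le J) U₀) B)⁻¹))) 0)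
          ((fun b => imVec (su2Quat (descendTo F ℰp (J + t) (J + k) (Nat.add_le_add_left ht.le J) (fun ℓ => expPoint (ζ ℓ) * U₀ ℓ : GaugeField (F.P (J + k)) 0 (Matrix.specialUnitaryGroup (Fin 2) ℂ)) b *
              (descendTo F ℰp (J + t) (J + k) (Nat.add_le_add_left ht.le J) U₀ b)⁻¹))) -
            (fderiv ℝ (fun (w : PBond (F.P (J + (t + 1))) 0 → EuclideanSpace ℝ (Fin 3)) (b : PBond (F.P (J + t)) 0) =>
                imVec (su2Quat (descendTo F ℰp (J + t) (J + (t + 1)) (Nat.add_le_add_left (Nat.le_succ t) J)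
                  (fun ℓ => expPoint (w ℓ) * descendTo F ℰp (J + (t + 1)) (J + k) (Nat.add_le_add_left (Nat.succ_le_of_lt ht) J) U₀ ℓ) b *
                  (descendTo F ℰp (J + t) (J + (t + 1)) (Nat.add_le_add_left (Nat.le_succ t) J)
                    (descendTo F ℰp (J + (t + 1)) (J + k) (Nat.add_le_add_left (Nat.succ_le_of_lt ht) J) U₀) b)⁻¹))) 0)
              (fun ℓ => imVec (su2Quat (descendTo F ℰp (J + (t + 1)) (J + k) (Nat.add_le_add_left (Nat.succ_le_of_lt ht) J) (fun ℓ => expPoint (ζ ℓ) * U₀ ℓ : GaugeField (F.P (J + k)) 0 (Matrix.specialUnitaryGroup (Fin 2) ℂ)) ℓ *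
                (descendTo F ℰp (J + (t + 1)) (J + k) (Nat.add_le_add_left (Nat.succ_le_of_lt ht) J) U₀ ℓ)⁻¹))))
        else 0)) B‖ := Finset.sum_congr rfl fun B _ => by rw [hptw B]
    _ ≤ ∑ B : PBond (F.P J) 0, ∑ t ∈ Finset.range k, ‖(if ht : t < k then
          (fderiv ℝ (fun (y : PBond (F.P (J + t)) 0 → EuclideanSpace ℝ (Fin 3)) (B : PBond (F.P J) 0) =>
            imVec (su2Quat (descendTo F ℰp J (J + t) (Nat.le_add_right J t)
              (fun b => expPoint (y b) * descendTo F ℰp (J + t) (J + k) (Nat.add_le_add_left ht.le J) U₀ b) B *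
              (descendTo F ℰp J (J + t) (Nat.le_add_right J t) (descendTo F ℰp (J + t) (J + k) (Nat.add_le_add_left ht.le J) U₀) B)⁻¹))) 0)
          ((fun b => imVec (su2Quat (descendTo F ℰp (J + t) (J + k) (Nat.add_le_add_left ht.le J) (fun ℓ => expPoint (ζ ℓ) * U₀ ℓ : GaugeField (F.P (J + k)) 0 (Matrix.specialUnitaryGroup (Fin 2) ℂ)) b *
              (descendTo F ℰp (J + t) (J + k) (Nat.add_le_add_left ht.le J) U₀ b)⁻¹))) -
            (fderiv ℝ (fun (w : PBond (F.P (J + (t + 1))) 0 → EuclideanSpace ℝ (Fin 3)) (b : PBond (F.P (J + t)) 0) =>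
                imVec (su2Quat (descendTo F ℰp (J + t) (J + (t + 1)) (Nat.add_le_add_left (Nat.le_succ t) J)
                  (fun ℓ => expPoint (w ℓ) * descendTo F ℰp (J + (t + 1)) (J + k) (Nat.add_le_add_left (Nat.succ_le_of_lt ht) J) U₀ ℓ) b *
                  (descendTo F ℰp (J + t) (J + (t + 1)) (Nat.add_le_add_left (Nat.le_succ t) J)
                    (descendTo F ℰp (J + (t + 1)) (J + k) (Nat.add_le_add_left (Nat.succ_le_of_lt ht) J) U₀) b)⁻¹))) 0)
              (fun ℓ => imVec (su2Quat (descendTo F ℰp (J + (t + 1)) (J + k) (Nat.add_le_add_left (Nat.succ_le_of_lt ht) J) (fun ℓ => expPoint (ζ ℓ) * U₀ ℓ : GaugeField (F.P (J + k)) 0 (Matrix.specialUnitaryGroup (Fin 2) ℂ)) ℓ *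
                (descendTo F ℰp (J + (t + 1)) (J + k) (Nat.add_le_add_left (Nat.succ_le_of_lt ht) J) U₀ ℓ)⁻¹))))
        else 0) B‖ := by
        refine Finset.sum_le_sum fun B _ => ?_
        rw [Finset.sum_apply]
        exact norm_sum_le _ _
    _ = ∑ t ∈ Finset.range k, ∑ B : PBond (F.P J) 0, ‖(if ht : t < k then
          (fderiv ℝ (fun (y : PBond (F.P (J + t)) 0 → EuclideanSpace ℝ (Fin 3)) (B : PBond (F.P J) 0) =>
            imVec (su2Quat (descendTo F ℰp J (J + t) (Nat.le_add_right J t)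
              (fun b => expPoint (y b) * descendTo F ℰp (J + t) (J + k) (Nat.add_le_add_left ht.le J) U₀ b) B *
              (descendTo F ℰp J (J + t) (Nat.le_add_right J t) (descendTo F ℰp (J + t) (J + k) (Nat.add_le_add_left ht.le J) U₀) B)⁻¹))) 0)
          ((fun b => imVec (su2Quat (descendTo F ℰp (J + t) (J + k) (Nat.add_le_add_left ht.le J) (fun ℓ => expPoint (ζ ℓ) * U₀ ℓ : GaugeField (F.P (J + k)) 0 (Matrix.specialUnitaryGroup (Fin 2) ℂ)) b *
              (descendTo F ℰp (J + t) (J + k) (Nat.add_le_add_left ht.le J) U₀ b)⁻¹))) -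
            (fderiv ℝ (fun (w : PBond (F.P (J + (t + 1))) 0 → EuclideanSpace ℝ (Fin 3)) (b : PBond (F.P (J + t)) 0) =>
                imVec (su2Quat (descendTo F ℰp (J + t) (J + (t + 1)) (Nat.add_le_add_left (Nat.le_succ t) J)
                  (fun ℓ => expPoint (w ℓ) * descendTo F ℰp (J + (t + 1)) (J + k) (Nat.add_le_add_left (Nat.succ_le_of_lt ht) J) U₀ ℓ) b *
                  (descendTo F ℰp (J + t) (J + (t + 1)) (Nat.add_le_add_left (Nat.le_succ t) J)
                    (descendTo F ℰp (J + (t + 1)) (J + k) (Nat.add_le_add_left (Nat.succ_le_of_lt ht) J) U₀) b)⁻¹))) 0)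
              (fun ℓ => imVec (su2Quat (descendTo F ℰp (J + (t + 1)) (J + k) (Nat.add_le_add_left (Nat.succ_le_of_lt ht) J) (fun ℓ => expPoint (ζ ℓ) * U₀ ℓ : GaugeField (F.P (J + k)) 0 (Matrix.specialUnitaryGroup (Fin 2) ℂ)) ℓ *
                (descendTo F ℰp (J + (t + 1)) (J + k) (Nat.add_le_add_left (Nat.succ_le_of_lt ht) J) U₀ ℓ)⁻¹))))
        else 0) B‖ := Finset.sum_comm
    _ ≤ ∑ t ∈ Finset.range k, ((1 + 4 * ((3 + 2 : ℕ) : ℝ)) * Real.exp (((3 + 2 : ℕ) : ℝ) * (422 + 1616 * ((3 + 2 : ℕ) : ℝ)) * ∑ i ∈ Finset.range (J + k - J), (((5 * F.L : ℕ) : ℝ) ^ 2 / 4) * θ (J + k - i))) * (4551000 * ((5 * F.L : ℕ) : ℝ) ^ 2) *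
        (if ht : t < J + k - J then
          (F.L : ℝ) ^ t * ∑ B : PBond (F.P J) 0,
            ‖(fun ℓ' : PBond (F.P (J + (t + 1))) 0 =>
              if ∃ b : PBond (F.P (J + t)) 0,
                ((B14.Eq22Determines.blockIter (J + t - J) b.src = (bondShift (F.sitesPerDir_eq (m := F.m) (K := J) (j := 0) (m' := F.m) (K' := J + t) (j' := J + t - J) (by omega)) B).src ∨ B14.Eq22Determines.blockIter (J + t - J) b.src = (bondShift (F.sitesPerDir_eq (m := F.m) (K := J) (j := 0) (m' := F.m) (K' := J + t) (j' := J + t - J) (by omega)) B).tgt) ∧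
                (B14.Eq22Determines.blockIter (J + t - J) b.tgt = (bondShift (F.sitesPerDir_eq (m := F.m) (K := J) (j := 0) (m' := F.m) (K' := J + t) (j' := J + t - J) (by omega)) B).src ∨ B14.Eq22Determines.blockIter (J + t - J) b.tgt = (bondShift (F.sitesPerDir_eq (m := F.m) (K := J) (j := 0) (m' := F.m) (K' := J + t) (j' := J + t - J) (by omega)) B).tgt)) ∧
                (blockOf ℓ'.src = (bondShift (F.sitesPerDir_eq (m := F.m) (K := J + t) (j := 0) (m' := F.m) (K' := J + t + 1) (j' := 1) (by omega)) b).src ∨ blockOf ℓ'.src = (bondShift (F.sitesPerDir_eq (m := F.m) (K := J + t) (j := 0) (m' := F.m) (K' := J + t + 1) (j' := 1) (by omega)) b).tgt)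
              then logVec (su2Quat (descendTo F ℰp (J + (t + 1)) (J + k) (by omega) (fun ℓ => expPoint (ζ ℓ) * U₀ ℓ : GaugeField (F.P (J + k)) 0 (Matrix.specialUnitaryGroup (Fin 2) ℂ)) ℓ' * (descendTo F ℰp (J + (t + 1)) (J + k) (by omega) U₀ ℓ')⁻¹)) else 0)‖ ^ 2
        else 0) := by
        refine Finset.sum_le_sum fun t htm => ?_
        have ht' : t < k := Finset.mem_range.1 htm
        have ht'' : t < J + k - J := by omega
        rw [dif_pos ht', dif_pos ht'']
        exact term_le (F := F) hJK ht'' hθ0 hθα hα24 hαδ hαL hUg (fun ℓ => expPoint (ζ ℓ) * U₀ ℓ)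
    _ ≤ ((1 + 4 * ((3 + 2 : ℕ) : ℝ)) * Real.exp (((3 + 2 : ℕ) : ℝ) * (422 + 1616 * ((3 + 2 : ℕ) : ℝ)) * ∑ i ∈ Finset.range (J + k - J), (((5 * F.L : ℕ) : ℝ) ^ 2 / 4) * θ (J + k - i))) * (4551000 * ((5 * F.L : ℕ) : ℝ) ^ 2) *
        (C_ST * Real.exp (c_ST * ∑ i ∈ Finset.range (J + k - J), (((5 * F.L : ℕ) : ℝ) ^ 2 / 4) * θ (J + k - i)) * (((F.L : ℝ)⁻¹) ^ (J + k - J) * ∑ ℓ : PBond (F.P (J + k)) 0, ‖ζ ℓ‖ ^ 2 +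
                (F.L : ℝ) ^ (J + k - J) * ∑ p : Plaq (F.P (J + k)) 0,
                  (1 - reTr ((GaugeField.plaqHol U₀ p)⁻¹ * GaugeField.plaqHol (fun ℓ => expPoint (ζ ℓ) * U₀ ℓ : GaugeField (F.P (J + k)) 0 (Matrix.specialUnitaryGroup (Fin 2) ℂ)) p)))) := by
        rw [← Finset.mul_sum, ← hrange]
        exact mul_le_mul_of_nonneg_left hST hCP0
    _ = _ := by rw [add_mul _ c_ST, Real.exp_add]; ring

end Fixed

/-! ## §5 LOC VERBATIM (✓p828403 `taylor_of_local`'s `hLoc`) from the (ST) LETTER in LOC's own prefix -/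

section Letter

/-- ★★★ **LOC ⟸ THE SUP TOWER BUDGET LETTER (ST)**: the conclusion is ✓p828403 `taylor_of_local`'s hypothesis `hLoc` VERBATIM (so `avg2_of_local G Ax (loc_of_supTowerLetter G Ax hSTL)`
typechecks with no text between); the hypothesis `hSTL` is the (ST) letter in the SAME prefix (guards, `‖ζ ℓ‖ ≤ π`, partner `expPoint ζ • U₀ ∈ histGood`, `Ax`) with constants
`(C_ST, c_ST)`; LOC's constants are `C_T := (1 + 4·5)·4551000·(5L)²·C_ST`, `c := c₃ + c_ST`. [cite: Balaban1985Averaging, Prop. 3 (123) p.36, Prop. 4 (134)-(135) p.38,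
(139)-(147) pp.39-40, Prop. 5 (156)-(157) p.42; Balaban1987RG1, (0.4), (0.11) p.253; Balaban1985UV3, (7) p.257] -/
theorem loc_of_supTowerLetter
    (G : (F : T3Family) → (J : ℕ) → GaugeField (F.P J) 0 (Matrix.specialUnitaryGroup (Fin 2) ℂ) → Prop)
    (Ax : (F : T3Family) → (J K : ℕ) → (hJK : J ≤ K) → GaugeField (F.P K) 0 (Matrix.specialUnitaryGroup (Fin 2) ℂ) →
      GaugeField (F.P K) 0 (Matrix.specialUnitaryGroup (Fin 2) ℂ) → Prop)
    (hSTL : ∀ (L : ℕ), 1 < L → ∃ C_ST : ℝ, 0 ≤ C_ST ∧ ∃ c_ST : ℝ, 0 ≤ c_ST ∧ ∀ (F : T3Family), F.L = L →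
      ∀ (J K : ℕ) (hJK : J ≤ K) (θ : ℕ → ℝ), (∀ i, 0 ≤ θ i) → ∀ (α : ℝ), (∀ i, J < i → i ≤ K → (((5 * F.L : ℕ) : ℝ) ^ 2 / 4) * θ i ≤ α) →
        α ≤ 1 / 24 → α < deltaSU (Fin 2) → 157 * α < ((F.L : ℝ) ^ 2)⁻¹ →
        ∀ U₀ : GaugeField (F.P K) 0 (Matrix.specialUnitaryGroup (Fin 2) ℂ), U₀ ∈ histGood F ℰp θ K J →
        ∀ ζ : PBond (F.P K) 0 → EuclideanSpace ℝ (Fin 3), (∀ ℓ, ‖ζ ℓ‖ ≤ Real.pi) →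
          (fun ℓ => expPoint (ζ ℓ) * U₀ ℓ : GaugeField (F.P K) 0 (Matrix.specialUnitaryGroup (Fin 2) ℂ)) ∈ histGood F ℰp θ K J →
            Ax F J K hJK (fun ℓ => expPoint (ζ ℓ) * U₀ ℓ) U₀ →
            ∑ t ∈ Finset.range (K - J), (if ht : t < K - J then
          (F.L : ℝ) ^ t * ∑ B : PBond (F.P J) 0,
            ‖(fun ℓ' : PBond (F.P (J + (t + 1))) 0 =>
              if ∃ b : PBond (F.P (J + t)) 0,
                ((B14.Eq22Determines.blockIter (J + t - J) b.src = (bondShift (F.sitesPerDir_eq (m := F.m) (K := J) (j := 0) (m' := F.m) (K' := J + t) (j' := J + t - J) (by omega)) B).src ∨ B14.Eq22Determines.blockIter (J + t - J) b.src = (bondShift (F.sitesPerDir_eq (m := F.m) (K := J) (j := 0) (m' := F.m) (K' := J + t) (j' := J + t - J) (by omega)) B).tgt) ∧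
                (B14.Eq22Determines.blockIter (J + t - J) b.tgt = (bondShift (F.sitesPerDir_eq (m := F.m) (K := J) (j := 0) (m' := F.m) (K' := J + t) (j' := J + t - J) (by omega)) B).src ∨ B14.Eq22Determines.blockIter (J + t - J) b.tgt = (bondShift (F.sitesPerDir_eq (m := F.m) (K := J) (j := 0) (m' := F.m) (K' := J + t) (j' := J + t - J) (by omega)) B).tgt)) ∧
                (blockOf ℓ'.src = (bondShift (F.sitesPerDir_eq (m := F.m) (K := J + t) (j := 0) (m' := F.m) (K' := J + t + 1) (j' := 1) (by omega)) b).src ∨ blockOf ℓ'.src = (bondShift (F.sitesPerDir_eq (m := F.m) (K := J + t) (j := 0) (m' := F.m) (K' := J + t + 1) (j' := 1) (by omega)) b).tgt)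
              then logVec (su2Quat (descendTo F ℰp (J + (t + 1)) K (by omega) (fun ℓ => expPoint (ζ ℓ) * U₀ ℓ : GaugeField (F.P K) 0 (Matrix.specialUnitaryGroup (Fin 2) ℂ)) ℓ' * (descendTo F ℰp (J + (t + 1)) K (by omega) U₀ ℓ')⁻¹)) else 0)‖ ^ 2
        else 0) ≤
              C_ST * Real.exp (c_ST * ∑ i ∈ Finset.range (K - J), (((5 * F.L : ℕ) : ℝ) ^ 2 / 4) * θ (K - i)) * (((F.L : ℝ)⁻¹) ^ (K - J) * ∑ ℓ : PBond (F.P K) 0, ‖ζ ℓ‖ ^ 2 +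
                (F.L : ℝ) ^ (K - J) * ∑ p : Plaq (F.P K) 0,
                  (1 - reTr ((GaugeField.plaqHol U₀ p)⁻¹ * GaugeField.plaqHol (fun ℓ => expPoint (ζ ℓ) * U₀ ℓ : GaugeField (F.P K) 0 (Matrix.specialUnitaryGroup (Fin 2) ℂ)) p)))) :
    ∀ (L : ℕ), 1 < L → ∃ C_T : ℝ, 0 ≤ C_T ∧ ∃ c : ℝ, 0 ≤ c ∧ ∀ (F : T3Family), F.L = L →
      ∀ (J K : ℕ) (hJK : J ≤ K) (θ : ℕ → ℝ), (∀ i, 0 ≤ θ i) → ∀ (α : ℝ), (∀ i, J < i → i ≤ K → (((5 * F.L : ℕ) : ℝ) ^ 2 / 4) * θ i ≤ α) →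
        α ≤ 1 / 24 → α < deltaSU (Fin 2) → 157 * α < ((F.L : ℝ) ^ 2)⁻¹ →
        ∀ U₀ : GaugeField (F.P K) 0 (Matrix.specialUnitaryGroup (Fin 2) ℂ), U₀ ∈ histGood F ℰp θ K J →
        ∀ ζ : PBond (F.P K) 0 → EuclideanSpace ℝ (Fin 3), (∀ ℓ, ‖ζ ℓ‖ ≤ Real.pi) →
          (fun ℓ => expPoint (ζ ℓ) * U₀ ℓ : GaugeField (F.P K) 0 (Matrix.specialUnitaryGroup (Fin 2) ℂ)) ∈ histGood F ℰp θ K J →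
            Ax F J K hJK (fun ℓ => expPoint (ζ ℓ) * U₀ ℓ) U₀ →
            ∑ B : PBond (F.P J) 0, ‖imVec (su2Quat (descendTo F ℰp J K hJK (fun ℓ => expPoint (ζ ℓ) * U₀ ℓ) B * (descendTo F ℰp J K hJK U₀ B)⁻¹)) -
                (fderiv ℝ (fun (ζ : PBond (F.P K) 0 → EuclideanSpace ℝ (Fin 3)) (B : PBond (F.P J) 0) =>
                  imVec (su2Quat (descendTo F ℰp J K hJK (fun ℓ => expPoint (ζ ℓ) * U₀ ℓ) B * (descendTo F ℰp J K hJK U₀ B)⁻¹))) 0)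
                  (fun ℓ => Real.sinc ‖ζ ℓ‖ • ζ ℓ) B‖ ≤
              C_T * Real.exp (c * ∑ i ∈ Finset.range (K - J), (((5 * F.L : ℕ) : ℝ) ^ 2 / 4) * θ (K - i)) * (((F.L : ℝ)⁻¹) ^ (K - J) * ∑ ℓ : PBond (F.P K) 0, ‖ζ ℓ‖ ^ 2 +
                (F.L : ℝ) ^ (K - J) * ∑ p : Plaq (F.P K) 0,
                  (1 - reTr ((GaugeField.plaqHol U₀ p)⁻¹ * GaugeField.plaqHol (fun ℓ => expPoint (ζ ℓ) * U₀ ℓ : GaugeField (F.P K) 0 (Matrix.specialUnitaryGroup (Fin 2) ℂ)) p))) := by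
  have _hG := G
  intro L hL
  obtain ⟨C_ST, hCST, c_ST, hcST, H⟩ := hSTL L hL
  refine ⟨(1 + 4 * ((3 + 2 : ℕ) : ℝ)) * (4551000 * ((5 * L : ℕ) : ℝ) ^ 2) * C_ST, by positivity,
    ((3 + 2 : ℕ) : ℝ) * (422 + 1616 * ((3 + 2 : ℕ) : ℝ)) + c_ST, by positivity, ?_⟩
  intro F hF J K hJK θ hθ0 α hθα hα24 hαδ hαL U₀ hUg ζ hζ hWg hAx
  have key := local_of_supTower (F := F) hJK hθ0 hθα hα24 hαδ hαL hUg ζ C_ST c_ST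
    (H F hF J K hJK θ hθ0 α hθα hα24 hαδ hαL U₀ hUg ζ hζ hWg hAx)
  have hC : (1 + 4 * ((3 + 2 : ℕ) : ℝ)) * (4551000 * ((5 * L : ℕ) : ℝ) ^ 2) * C_ST =
      (1 + 4 * ((3 + 2 : ℕ) : ℝ)) * (4551000 * ((5 * F.L : ℕ) : ℝ) ^ 2) * C_ST := by rw [hF]
  rw [hC]
  exact key

end Letter

end Summit.QuantumFields.YangMills.Theorems.FluctuationComparisonRegPrIntLS2BetaLocalOfSupTower

end
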